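import Mathlib.Algebra.DirectSum.Module
import Literature.AlgebraicTopology.SingularHomology.ClopenAdditivity
import Literature.AlgebraicTopology.SingularHomology.ExcisionTheorem
import HarnessLib

/-!
# Additivity of RELATIVE singular homology over a clopen partition (arbitrary index set)

Topic `Literature/AlgebraicTopology/SingularHomology`. A. Hatcher, *Algebraic Topology* (2002),
Prop. 2.6 / §2.3 axiom (4) ("additivity": for a decomposition of `X` into pairwise disjoint open
sets `Uᵢ` the inclusions induce an isomorphism `⊕ᵢ Hₙ(Uᵢ) ≅ Hₙ(X)`). The tree's
`ClopenAdditivity.lean` proves the ABSOLUTE form (`singularHomology.clopenPartitionEquiv`, any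
coefficients, arbitrary index set); this file proves the RELATIVE form
`⊕ᵢ Hₙ(Uᵢ, Uᵢ ↓∩ A; M) ≅ Hₙ(X, A; M)` for the tree's `relativeSingularHomology`, reusing the
clopen-partition API of that file (`IsClopenPartition`, `color`, `pieceRetr`, `pieceRetraction`).
The relative form is the additivity used to compute the `E¹` term
`Hₙ(E_s, E_{s-1}) ≈ ⊕_{s-cells} Hₙ(p⁻¹e, p⁻¹ė)` of the spectral sequence of a fibration over an
infinite complex (E. H. Spanier, *Algebraic Topology* (1981), Ch. 9, Sec. 2, Lemma 2: "a direct-sum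
representation"), a brick of the printed proof of
`Literature.AlgebraicTopology.Homotopy.Spanier1981_eulerChar_fibreBundle`.

Proof (concrete chains `CChain M X n = SingularSimplex X n →₀ M` of `SingularChainsConcrete.lean`):
every singular simplex has its (connected) image in exactly one `Uᵢ` (`IsClopenPartition.color`);
the filters `projᵢ` of a chain by `color = i` are chain maps summing to the identity (finitely on
each chain), and the restrictions `pieceRetr (Uᵢ) : C(X) → C(Uᵢ)` are chain maps with
`resᵢ ∘ (inclⱼ)♯ = δᵢⱼ` and `(inclᵢ)♯ ∘ resᵢ = projᵢ`, preserving the chains of `A`; on relative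
homology this gives that `(aᵢ)ᵢ ↦ Σᵢ (inclᵢ)_* aᵢ : ⊕ᵢ Hₙ(Uᵢ, Uᵢ ↓∩ A) → Hₙ(X, A)` is bijective
(`relativeSingularHomology.directSum_bijective`). No named fact is introduced.

## References

* A. Hatcher, *Algebraic Topology*, CUP (2002), Prop. 2.6, §2.3 axiom (4). [HatcherAT2002]
* E. H. Spanier, *Algebraic Topology*, Springer (1981), Ch. 9, Sec. 2, Lemma 2; Ch. 4, Sec. 8,
  Thm. 10 (additivity for singular theory). [Spanier1981]
-/

noncomputable section

-- as in `SingularChainsConcrete`: chains of the concrete complex are `Finsupp`s up to unfolding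
set_option backward.isDefEq.respectTransparency false

open CategoryTheory Limits Topology Set

universe u v w

namespace Literature.AlgebraicTopology.SingularHomology

variable (R : Type v) [CommRing R] (M : Type v) [AddCommGroup M] [Module R M]
variable {X : Type u} [TopologicalSpace X] {ι : Type w}

/-! ### `pieceRetr` on an elementary chain -/

namespace csingularChainComplex

open Classical in
/-- `pieceRetr` of an elementary chain: the corestricted simplex if its image lies in `A`,
else `0` (`pieceRetr_single_of_subset` / `pieceRetr_single_of_not_subset` of
`ClopenAdditivity.lean` in one formula). [folklore] -/
theorem pieceRetr_single (A : Set X) {n : ℕ} (σ : SingularSimplex X n) (m : M) :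
    pieceRetr (R := R) A n (Finsupp.single σ m) =
      if h : σ.range ⊆ A then Finsupp.single (σ.codRestrict A h) m else 0 := by
  split_ifs with h
  · exact pieceRetr_single_of_subset A h m
  · exact pieceRetr_single_of_not_subset A h m

end csingularChainComplex

namespace IsClopenPartition

variable {U : ι → Set X} (hU : IsClopenPartition U)
include hU

/-! ### The projections `projᵢ` and the restrictions `resᵢ` on chains -/

open Classical in
/-- **`projᵢ`**: keep the simplices with image in `Uᵢ` (a linear endomorphism of `Cₙ(X; M)`).
[folklore] -/
def proj (i : ι) (n : ℕ) : CChain M X n →ₗ[R] CChain M X n where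
  toFun c := c.filter fun σ => hU.color σ = i
  map_add' _ _ := Finsupp.filter_add
  map_smul' _ _ := Finsupp.filter_smul

open Classical in
/-- Pointwise formula for `projᵢ`. [folklore] -/
theorem proj_apply (i : ι) {n : ℕ} (c : CChain M X n) (σ : SingularSimplex X n) :
    hU.proj R M i n c σ = if hU.color σ = i then c σ else 0 := by
  show (c.filter fun σ => hU.color σ = i) σ = _
  rw [Finsupp.filter_apply]

open Classical in
/-- `projᵢ` of an elementary chain. [folklore] -/
theorem proj_single (i : ι) {n : ℕ} (σ : SingularSimplex X n) (m : M) :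
    hU.proj R M i n (Finsupp.single σ m) = if hU.color σ = i then Finsupp.single σ m else 0 := by
  classical
  show (Finsupp.single σ m).filter (fun σ => hU.color σ = i) = _
  split_ifs with h
  · exact Finsupp.filter_single_of_pos _ h
  · exact Finsupp.filter_single_of_neg _ h

/-- `projᵢ c` is a chain of `Uᵢ`. [folklore] -/
theorem proj_mem_chainsIn (i : ι) {n : ℕ} (c : CChain M X n) :
    hU.proj R M i n c ∈ chainsIn R M X (U i) n := by
  rw [mem_chainsIn_iff]
  intro σ hσ
  rw [Finsupp.mem_support_iff, proj_apply] at hσ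
  by_cases h : hU.color σ = i
  · exact h ▸ hU.range_subset_color σ
  · exact absurd (if_neg h) hσ

/-- `projᵢ` preserves the chains of any subspace. [folklore] -/
theorem proj_mem_chainsIn_of_mem (i : ι) {A : Set X} {n : ℕ} {c : CChain M X n}
    (hc : c ∈ chainsIn R M X A n) : hU.proj R M i n c ∈ chainsIn R M X A n := by
  rw [mem_chainsIn_iff] at hc ⊢
  intro σ hσ
  rw [Finsupp.mem_support_iff, proj_apply] at hσ
  by_cases h : hU.color σ = i
  · rw [if_pos h] at hσ
    exact hc σ (Finsupp.mem_support_iff.2 hσ)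
  · exact absurd (if_neg h) hσ

/-- A chain of `Uᵢ` is fixed by `projᵢ`. [folklore] -/
theorem proj_eq_self_of_mem (i : ι) {n : ℕ} {c : CChain M X n} (hc : c ∈ chainsIn R M X (U i) n) :
    hU.proj R M i n c = c := by
  classical
  show c.filter (fun σ => hU.color σ = i) = c
  rw [Finsupp.filter_eq_self_iff]
  intro σ hσ
  exact hU.color_eq_iff.2 ((mem_chainsIn_iff R M c).1 hc σ (Finsupp.mem_support_iff.2 hσ))

/-- A chain of `Uⱼ` is killed by `projᵢ`, `i ≠ j`. [folklore] -/
theorem proj_eq_zero_of_mem {i j : ι} (hij : i ≠ j) {n : ℕ} {c : CChain M X n}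
    (hc : c ∈ chainsIn R M X (U j) n) : hU.proj R M i n c = 0 := by
  ext σ
  rw [proj_apply, Finsupp.zero_apply]
  by_cases h : hU.color σ = i
  · rw [if_pos h]
    by_contra hσ
    have hj := hU.color_eq_iff.2 ((mem_chainsIn_iff R M c).1 hc σ (Finsupp.mem_support_iff.2 hσ))
    exact hij (h.symm.trans hj)
  · rw [if_neg h]

open Classical in
/-- **`projᵢ` is a chain map**: `∂ ∘ projᵢ = projᵢ ∘ ∂` (faces of a simplex in `Uᵢ` lie in
`Uᵢ`). [folklore] -/
theorem bd_proj (i : ι) {n : ℕ} (c : CChain M X (n + 1)) :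
    csingularChainComplex.bd R n (hU.proj R M i (n + 1) c) =
      hU.proj R M i n (csingularChainComplex.bd R n c) := by
  induction c using Finsupp.induction_linear with
  | zero => simp only [map_zero]
  | add f g hf hg => simp only [map_add, hf, hg]
  | single σ m =>
    rw [proj_single]
    split_ifs with h
    · -- all faces have index `i`
      rw [csingularChainComplex.bd_single, map_sum]
      refine (Finset.sum_congr rfl fun j _ => ?_).symm
      rw [map_smul, proj_single, hU.color_face, if_pos h]
    · rw [map_zero, csingularChainComplex.bd_single, map_sum]
      refine (Finset.sum_eq_zero fun j _ => ?_).symm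
      rw [map_smul, proj_single, hU.color_face, if_neg h, smul_zero]

/-- **A chain is the (finite) sum of its projections** over the indices of its simplices.
[folklore] -/
theorem sum_proj_eq [DecidableEq ι] {n : ℕ} (c : CChain M X n) :
    ∑ i ∈ c.support.image hU.color, hU.proj R M i n c = c := by
  ext σ
  rw [Finsupp.finsetSum_apply]
  by_cases hσ : σ ∈ c.support
  · rw [Finset.sum_eq_single (hU.color σ)]
    · rw [proj_apply, if_pos rfl]
    · intro i _ hi
      rw [proj_apply, if_neg (Ne.symm hi)]
    · intro h
      exact absurd (Finset.mem_image_of_mem _ hσ) h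
  · rw [Finsupp.notMem_support_iff.1 hσ]
    refine Finset.sum_eq_zero fun i _ => ?_
    rw [proj_apply]
    split_ifs
    · exact Finsupp.notMem_support_iff.1 hσ
    · rfl

/-- `projᵢ c = 0` for `i` not the index of a simplex of `c`. [folklore] -/
theorem proj_eq_zero_of_notMem [DecidableEq ι] {n : ℕ} (c : CChain M X n) {i : ι}
    (hi : i ∉ c.support.image hU.color) : hU.proj R M i n c = 0 := by
  ext σ
  rw [proj_apply, Finsupp.zero_apply]
  split_ifs with h
  · by_contra hσ
    exact hi (Finset.mem_image.2 ⟨σ, Finsupp.mem_support_iff.2 hσ, h⟩)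
  · rfl

open Classical in
/-- **`(inclᵢ)♯ ∘ resᵢ = projᵢ`**. [folklore] -/
theorem mapDomain_pieceRetr (i : ι) {n : ℕ} (c : CChain M X n) :
    Finsupp.mapDomain (fun τ : SingularSimplex (U i) n => τ.map ⟨Subtype.val, continuous_subtype_val⟩)
      (csingularChainComplex.pieceRetr (R := R) (U i) n c) = hU.proj R M i n c := by
  induction c using Finsupp.induction_linear with
  | zero => rw [map_zero, map_zero, Finsupp.mapDomain_zero]
  | add f g hf hg => rw [map_add, map_add, Finsupp.mapDomain_add, hf, hg]
  | single σ m =>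
    rw [csingularChainComplex.pieceRetr_single, proj_single]
    by_cases h : σ.range ⊆ U i
    · rw [dif_pos h, if_pos (hU.color_eq_iff.2 h), Finsupp.mapDomain_single,
        SingularSimplex.codRestrict_map_val]
    · rw [dif_neg h, if_neg (fun h' => h (hU.color_eq_iff.1 h')), Finsupp.mapDomain_zero]

/-- **`resᵢ ∘ (inclᵢ)♯ = 𝟙`**. [folklore] -/
theorem pieceRetr_mapDomain_self (i : ι) {n : ℕ} (c : CChain M (U i) n) :
    csingularChainComplex.pieceRetr (R := R) (U i) n (Finsupp.mapDomain
      (fun τ : SingularSimplex (U i) n => τ.map ⟨Subtype.val, continuous_subtype_val⟩) c) = c := by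
  apply mapDomain_val_injective (M := M) (U i) n
  rw [mapDomain_pieceRetr]
  exact hU.proj_eq_self_of_mem R M i (by
    rw [← range_lmapDomain_val]; exact LinearMap.mem_range_self _ c)

/-- **`resᵢ ∘ (inclⱼ)♯ = 0`** for `i ≠ j`. [folklore] -/
theorem pieceRetr_mapDomain_of_ne {i j : ι} (hij : i ≠ j) {n : ℕ} (c : CChain M (U j) n) :
    csingularChainComplex.pieceRetr (R := R) (U i) n (Finsupp.mapDomain
      (fun τ : SingularSimplex (U j) n => τ.map ⟨Subtype.val, continuous_subtype_val⟩) c) = 0 := by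
  apply mapDomain_val_injective (M := M) (U i) n
  rw [mapDomain_pieceRetr, Finsupp.mapDomain_zero]
  exact hU.proj_eq_zero_of_mem R M hij (by
    rw [← range_lmapDomain_val]; exact LinearMap.mem_range_self _ c)

/-! ### The restriction as a chain map, and on relative homology -/

omit hU in
/-- The corestriction of a simplex with image in `A` has image in `Uᵢ ↓∩ A`. [folklore] -/
theorem range_codRestrict_subset {A : Set X} {n : ℕ} {σ : SingularSimplex X n} (hσ : σ.range ⊆ A)
    {i : ι} (h : σ.range ⊆ U i) : (σ.codRestrict (U i) h).range ⊆ Subtype.val ⁻¹' A := by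
  intro x hx
  have h1 : (x : X) ∈ ((σ.codRestrict (U i) h).map ⟨Subtype.val, continuous_subtype_val⟩).range := by
    rw [SingularSimplex.range_map]; exact ⟨x, hx, rfl⟩
  rw [SingularSimplex.codRestrict_map_val] at h1
  exact hσ h1

omit hU in
/-- `resᵢ` sends chains of `A` to chains of `Uᵢ ↓∩ A`. [folklore] -/
theorem pieceRetr_mem_chainsIn (i : ι) {A : Set X} {n : ℕ} {c : CChain M X n} (hc : c ∈ chainsIn R M X A n) :
    csingularChainComplex.pieceRetr (R := R) (U i) n c ∈ chainsIn R M ↥(U i) (Subtype.val ⁻¹' A) n := by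
  classical
  rw [← Finsupp.sum_single c, Finsupp.sum, map_sum]
  refine Submodule.sum_mem _ fun σ hσ => ?_
  rw [csingularChainComplex.pieceRetr_single]
  split_ifs with h
  · exact single_mem_chainsIn R M (range_codRestrict_subset ((mem_chainsIn_iff R M c).1 hc σ hσ) h) _
  · exact Submodule.zero_mem _

/-- `C(A) ≤ comap resᵢ C(Uᵢ ↓∩ A)`. [folklore] -/
theorem chainsInSub_le_comap_pieceRetraction (i : ι) (A : Set X) :
    chainsInSub R M X A ≤ (chainsInSub R M ↥(U i) (Subtype.val ⁻¹' A)).comap (csingularChainComplex.pieceRetraction (R := R) (M := M) hU i) :=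
  fun _ _ hc => pieceRetr_mem_chainsIn R M i hc

/-- **`Θᵢ : Hₙ(X, A) → Hₙ(Uᵢ, Uᵢ ↓∩ A)` induced by `resᵢ`** (concrete model). [folklore] -/
def resHomologyMap (i : ι) (A : Set X) (n : ℕ) :
    (chainsInSub R M X A).quotient.homology n ⟶
      (chainsInSub R M ↥(U i) (Subtype.val ⁻¹' A)).quotient.homology n :=
  HomologicalComplex.homologyMap (Subcomplex.quotMap (csingularChainComplex.pieceRetraction (R := R) (M := M) hU i) _ _
    (hU.chainsInSub_le_comap_pieceRetraction R M i A)) n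

omit hU in
/-- **`(inclᵢ)_* : Hₙ(Uᵢ, Uᵢ ↓∩ A) → Hₙ(X, A)`** (concrete model). [folklore] -/
def inclHomologyMap (U : ι → Set X) (i : ι) (A : Set X) (n : ℕ) :
    (chainsInSub R M ↥(U i) (Subtype.val ⁻¹' A)).quotient.homology n ⟶
      (chainsInSub R M X A).quotient.homology n :=
  HomologicalComplex.homologyMap (Subcomplex.quotMap
    (csingularChainComplex.map R M (⟨Subtype.val, continuous_subtype_val⟩ : C(↥(U i), X))) _ _
    (chainsInSub_le_comap_map R M _ (Set.mapsTo_preimage Subtype.val A))) n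

/-- **`Θᵢ ∘ (inclᵢ)_* = 𝟙`** on `Hₙ(Uᵢ, Uᵢ ↓∩ A)`. [folklore] -/
theorem resHomologyMap_inclHomologyMap_self (i : ι) (A : Set X) (n : ℕ)
    (a : (chainsInSub R M ↥(U i) (Subtype.val ⁻¹' A)).quotient.homology n) :
    hU.resHomologyMap R M i A n (inclHomologyMap R M U i A n a) = a := by
  obtain ⟨y, hy, rfl⟩ := (chainsInSub R M ↥(U i) (Subtype.val ⁻¹' A)).relCls_surjective a
  rw [inclHomologyMap, Subcomplex.homologyMap_quotMap_relCls, resHomologyMap,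
    Subcomplex.homologyMap_quotMap_relCls]
  refine (chainsInSub R M ↥(U i) (Subtype.val ⁻¹' A)).relCls_congr ?_ _ _
  rw [csingularChainComplex.pieceRetraction_f_apply, csingularChainComplex.map_f_apply]
  exact hU.pieceRetr_mapDomain_self R M i y

/-- **`Θᵢ ∘ (inclⱼ)_* = 0`** for `i ≠ j`. [folklore] -/
theorem resHomologyMap_inclHomologyMap_of_ne {i j : ι} (hij : i ≠ j) (A : Set X) (n : ℕ)
    (a : (chainsInSub R M ↥(U j) (Subtype.val ⁻¹' A)).quotient.homology n) :
    hU.resHomologyMap R M i A n (inclHomologyMap R M U j A n a) = 0 := by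
  obtain ⟨y, hy, rfl⟩ := (chainsInSub R M ↥(U j) (Subtype.val ⁻¹' A)).relCls_surjective a
  rw [inclHomologyMap, Subcomplex.homologyMap_quotMap_relCls, resHomologyMap,
    Subcomplex.homologyMap_quotMap_relCls]
  have h0 : (csingularChainComplex.pieceRetraction (R := R) (M := M) hU i).f n ((csingularChainComplex.map R M
      (⟨Subtype.val, continuous_subtype_val⟩ : C(↥(U j), X))).f n y) = 0 := by
    rw [csingularChainComplex.pieceRetraction_f_apply, csingularChainComplex.map_f_apply]
    exact hU.pieceRetr_mapDomain_of_ne R M hij y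
  exact ((chainsInSub R M ↥(U i) (Subtype.val ⁻¹' A)).relCls_congr h0 _
    (by rw [map_zero]; exact Submodule.zero_mem _)).trans
    ((chainsInSub R M ↥(U i) (Subtype.val ⁻¹' A)).relCls_zero _)

/-- **`(inclᵢ)_* (Θᵢ [x]) = [projᵢ x]`**. [folklore] -/
theorem inclHomologyMap_resHomologyMap_relCls (i : ι) (A : Set X) (n : ℕ) (x : CChain M X n)
    (hx : (csingularChainComplex R M X).d n ((ComplexShape.down ℕ).next n) x ∈
      chainsInSub R M X A ((ComplexShape.down ℕ).next n))
    (hpx : (csingularChainComplex R M X).d n ((ComplexShape.down ℕ).next n) (hU.proj R M i n x) ∈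
      chainsInSub R M X A ((ComplexShape.down ℕ).next n)) :
    inclHomologyMap R M U i A n (hU.resHomologyMap R M i A n ((chainsInSub R M X A).relCls x hx)) =
      (chainsInSub R M X A).relCls (hU.proj R M i n x) hpx := by
  rw [resHomologyMap, Subcomplex.homologyMap_quotMap_relCls, inclHomologyMap,
    Subcomplex.homologyMap_quotMap_relCls]
  refine (chainsInSub R M X A).relCls_congr ?_ _ _
  rw [csingularChainComplex.map_f_apply, csingularChainComplex.pieceRetraction_f_apply]
  exact hU.mapDomain_pieceRetr R M i x

/-- The boundary condition of a relative cycle passes to its projections. [folklore] -/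
theorem d_proj_mem (i : ι) (A : Set X) (n : ℕ) (x : CChain M X n)
    (hx : (csingularChainComplex R M X).d n ((ComplexShape.down ℕ).next n) x ∈
      chainsInSub R M X A ((ComplexShape.down ℕ).next n)) :
    (csingularChainComplex R M X).d n ((ComplexShape.down ℕ).next n) (hU.proj R M i n x) ∈
      chainsInSub R M X A ((ComplexShape.down ℕ).next n) := by
  cases n with
  | zero =>
    rw [(csingularChainComplex R M X).shape 0 _ (by simp)]
    exact Submodule.zero_mem _
  | succ k =>
    rw [ChainComplex.next_nat_succ] at hx ⊢
    rw [csingularChainComplex.d_apply] at hx ⊢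
    rw [hU.bd_proj R M]
    exact hU.proj_mem_chainsIn_of_mem R M i hx

/-- **A relative class is the sum of the push-forwards of its restrictions**:
`[x] = Σᵢ (inclᵢ)_* Θᵢ [x]` over any finite set of indices containing those of the simplices of
`x`. [folklore] -/
theorem sum_inclHomologyMap_resHomologyMap [DecidableEq ι] (A : Set X) (n : ℕ) (x : CChain M X n)
    (hx : (csingularChainComplex R M X).d n ((ComplexShape.down ℕ).next n) x ∈
      chainsInSub R M X A ((ComplexShape.down ℕ).next n))
    {s : Finset ι} (hs : x.support.image hU.color ⊆ s) :
    ∑ i ∈ s, inclHomologyMap R M U i A n (hU.resHomologyMap R M i A n ((chainsInSub R M X A).relCls x hx)) =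
      (chainsInSub R M X A).relCls x hx := by
  have hsum : ∀ t : Finset ι, ∑ i ∈ t, inclHomologyMap R M U i A n
      (hU.resHomologyMap R M i A n ((chainsInSub R M X A).relCls x hx)) =
      (chainsInSub R M X A).relCls (∑ i ∈ t, hU.proj R M i n x)
        (by rw [map_sum]; exact Submodule.sum_mem _ fun i _ => hU.d_proj_mem R M i A n x hx) := by
    intro t
    induction t using Finset.induction_on with
    | empty =>
      rw [Finset.sum_empty]
      symm
      exact ((chainsInSub R M X A).relCls_congr (Finset.sum_empty (f := fun i => hU.proj R M i n x)) _
        (by rw [map_zero]; exact Submodule.zero_mem _)).trans ((chainsInSub R M X A).relCls_zero _)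
    | insert j t hj ih =>
      rw [Finset.sum_insert hj, ih, hU.inclHomologyMap_resHomologyMap_relCls R M j A n x hx
        (hU.d_proj_mem R M j A n x hx)]
      have hmem : (csingularChainComplex R M X).d n ((ComplexShape.down ℕ).next n)
          (hU.proj R M j n x + ∑ i ∈ t, hU.proj R M i n x) ∈
            chainsInSub R M X A ((ComplexShape.down ℕ).next n) := by
        rw [map_add, map_sum]
        exact Submodule.add_mem _ (hU.d_proj_mem R M j A n x hx)
          (Submodule.sum_mem _ fun i _ => hU.d_proj_mem R M i A n x hx)
      rw [← (chainsInSub R M X A).relCls_add _ _ _ _ hmem]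
      exact (chainsInSub R M X A).relCls_congr (Finset.sum_insert hj).symm _ _
  rw [hsum s]
  refine (chainsInSub R M X A).relCls_congr ?_ _ _
  -- `Σ_{i ∈ s} projᵢ x = x`: the indices outside the image contribute `0`
  rw [← Finset.sum_subset hs fun i _ hi => hU.proj_eq_zero_of_notMem R M x hi]
  exact hU.sum_proj_eq R M x

/-! ### Additivity: `⊕ᵢ Hₙ(Uᵢ, Uᵢ ↓∩ A) ≅ Hₙ(X, A)` -/

/-- **Additivity of relative singular homology over a clopen decomposition, concrete model**:
the map `(aᵢ)ᵢ ↦ Σᵢ (inclᵢ)_* aᵢ : ⊕ᵢ Hₙ(Uᵢ, Uᵢ ↓∩ A; M) → Hₙ(X, A; M)` is bijective (Hatcher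
2002, Prop. 2.6 / additivity axiom, arbitrary index set; Spanier 1981, Ch. 4, Sec. 8, Thm. 10).
[cite: HatcherAT2002, Prop. 2.6] -/
theorem directSum_bijective_concrete [DecidableEq ι] (A : Set X) (n : ℕ) :
    Function.Bijective (DirectSum.toModule R ι ((chainsInSub R M X A).quotient.homology n)
      fun i => (inclHomologyMap R M U i A n).hom) := by
  set Ψ := DirectSum.toModule R ι ((chainsInSub R M X A).quotient.homology n)
      fun i => (inclHomologyMap R M U i A n).hom with hΨ
  -- `Θᵢ ∘ Ψ = componentᵢ`
  have hcomp : ∀ i, (hU.resHomologyMap R M i A n).hom ∘ₗ Ψ =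
      DirectSum.component R ι (fun i => (chainsInSub R M ↥(U i) (Subtype.val ⁻¹' A)).quotient.homology n) i := by
    intro i
    refine DirectSum.linearMap_ext R fun j => LinearMap.ext fun a => ?_
    simp only [LinearMap.comp_apply, hΨ, DirectSum.toModule_lof]
    by_cases hij : i = j
    · subst hij
      rw [DirectSum.component.lof_self]
      exact hU.resHomologyMap_inclHomologyMap_self R M i A n a
    · rw [DirectSum.component.of, dif_neg (Ne.symm hij)]
      exact hU.resHomologyMap_inclHomologyMap_of_ne R M hij A n a
  constructor
  · -- injective: all components of an element of the kernel vanish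
    intro d d' hdd'
    refine DirectSum.ext_component R fun i => ?_
    have h := congrArg (hU.resHomologyMap R M i A n).hom hdd'
    have hi := LinearMap.congr_fun (hcomp i)
    simp only [LinearMap.comp_apply] at hi
    rw [hi d, hi d'] at h
    exact h
  · -- surjective: a class is the sum of the push-forwards of its restrictions
    intro a
    obtain ⟨x, hx, rfl⟩ := (chainsInSub R M X A).relCls_surjective a
    refine ⟨∑ i ∈ x.support.image hU.color, DirectSum.lof R ι _ i
      (hU.resHomologyMap R M i A n ((chainsInSub R M X A).relCls x hx)), ?_⟩
    rw [map_sum]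
    simp only [hΨ, DirectSum.toModule_lof]
    exact hU.sum_inclHomologyMap_resHomologyMap R M A n x hx subset_rfl

end IsClopenPartition

/-- **Additivity of relative singular homology over a clopen decomposition** (Hatcher 2002,
Prop. 2.6 / §2.3 axiom (4), arbitrary index set; Spanier 1981, Ch. 4, Sec. 8, Thm. 10), for the
tree's `relativeSingularHomology`: if `U` is a family of pairwise disjoint open sets covering `X`,
then `(aᵢ)ᵢ ↦ Σᵢ (inclᵢ)_* aᵢ : ⊕ᵢ Hₙ(Uᵢ, Uᵢ ↓∩ A; M) → Hₙ(X, A; M)` is bijective.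
[cite: HatcherAT2002, Prop. 2.6] -/
theorem relativeSingularHomology.directSum_bijective [DecidableEq ι] {U : ι → Set X}
    (hU : IsClopenPartition U) (A : Set X) (n : ℕ) :
    Function.Bijective (DirectSum.toModule R ι (relativeSingularHomology R M X A n) fun i =>
      (relativeSingularHomology.map R M (subsetIncl (U i))
        (Set.mapsTo_preimage Subtype.val A : Set.MapsTo _ (Subtype.val ⁻¹' A) A) n).hom) := by
  -- comparison with the concrete model: `Ψ = eX⁻¹ ∘ Ψ_concrete ∘ L`
  let eX := (relativeSingularHomology.concreteIso R M X A n).toLinearEquiv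
  let L : (DirectSum ι fun i => relativeSingularHomology R M ↥(U i) (Subtype.val ⁻¹' A) n) →ₗ[R]
      DirectSum ι fun i => (chainsInSub R M ↥(U i) (Subtype.val ⁻¹' A)).quotient.homology n :=
    DirectSum.lmap fun i =>
      (relativeSingularHomology.concreteIso R M ↥(U i) (Subtype.val ⁻¹' A) n).toLinearEquiv.toLinearMap
  have hLbij : Function.Bijective L :=
    ⟨(DirectSum.lmap_injective _).2 fun i => LinearEquiv.injective _,
      (DirectSum.lmap_surjective _).2 fun i => LinearEquiv.surjective _⟩
  set Ψ := (DirectSum.toModule R ι (relativeSingularHomology R M X A n) fun i =>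
      (relativeSingularHomology.map R M (subsetIncl (U i))
        (Set.mapsTo_preimage Subtype.val A : Set.MapsTo _ (Subtype.val ⁻¹' A) A) n).hom) with hΨ
  set Ψc := (DirectSum.toModule R ι ((chainsInSub R M X A).quotient.homology n) fun i =>
      (IsClopenPartition.inclHomologyMap R M U i A n).hom) with hΨc
  have hfac : Ψ = eX.symm.toLinearMap ∘ₗ Ψc ∘ₗ L := by
    refine DirectSum.linearMap_ext R fun i => LinearMap.ext fun a => ?_
    simp only [LinearMap.comp_apply, hΨ, hΨc, DirectSum.toModule_lof, L, DirectSum.lmap_lof,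
      LinearEquiv.coe_coe]
    rw [relativeSingularHomology.map_eq_concrete]
    rfl
  rw [hfac, LinearMap.coe_comp, LinearMap.coe_comp]
  exact eX.symm.bijective.comp ((hU.directSum_bijective_concrete R M A n).comp hLbij)

end Literature.AlgebraicTopology.SingularHomology
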